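import Summits.Ventures.YMGap.RobustBall.EnergyVarianceDLR
import HarnessLib

/-!
# Robust ball (Y2), strong-coupling laws — the inverse Efron–Stein inequality for DLR states on `ℤ^d`, III: an explicit extensive family

HONEST FRAMING: venture file of the cell `pub-ymgap` (QuantumFields programme), track ROBUST-BALL, seat rb-p2 (g8).  LATTICE statement, every DLR
state of Wilson's `SU(N)` lattice gauge theory on `ℤ^d` (`N ≥ 2`, `d ≥ 2`), every real `β`.  An explicit instance of
`EnergyVarianceDLR.card_mul_le_variance_plaquetteSum`: the direction-`0` links based at `0, 2e₁, 4e₁, …, 2(n−1)e₁` lie pairwise on no common plaquette,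
so the plaquettes `P_n` through them (at most `2(d−1)n` of them) carry an energy variance `≥ n · e^{−8(d−1)N|β|} · V₀` in EVERY DLR state:
the energy variance per plaquette along this growing family is `≥ e^{−8(d−1)N|β|} V₀ / (2(d−1))`, uniformly in `n` and in the state
(`variance_linePlaquettes_ge`).  Lower companion of ds-1's `variance_sum_plaquette_le_of_massGapAt` (`≤ χ · #P` inside the mass-gap window).
Nothing about the continuum, a spectral gap or Clay. [folklore]
-/

noncomputable section

open MeasureTheory ProbabilityTheory Finset Function
open Literature.Probability.LatticeModels
open Literature.MathematicalPhysics.QuantumLattice Literature.MathematicalPhysics.QuantumFieldTheory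

namespace Summit.Ventures.YMGap.RobustBall

namespace EnergyVariance

variable {d N : ℕ} {G : Type*} [Group G] [TopologicalSpace G] [IsTopologicalGroup G] [CompactSpace G]
  [MeasurableSpace G] [BorelSpace G] [SecondCountableTopology G] [T2Space G] (ρ : G →* Matrix (Fin N) (Fin N) ℂ)

/-- **Two direction-`i` links of `ℤ^d` on a common plaquette** have equal base points or base points differing by a unit vector `e_j`, `j ≠ i`.
[folklore] -/
theorem mem_plaquetteEdges_same_dir {x x' : Literature.Probability.LatticeModels.Site d} {i : Fin d} {p : ZdPlaquette d}
    (hx : ((x, i) : Literature.MathematicalPhysics.QuantumLattice.ZdEdge d) ∈ plaquetteEdges p)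
    (hx' : ((x', i) : Literature.MathematicalPhysics.QuantumLattice.ZdEdge d) ∈ plaquetteEdges p) :
    x' = x ∨ ∃ j : Fin d, j ≠ i ∧ (x' = x + Pi.single j 1 ∨ x = x' + Pi.single j 1) := by
  obtain ⟨y, ⟨a, b⟩, hab⟩ := p
  have hne : a ≠ b := ne_of_lt hab
  simp only [plaquetteEdges, Finset.mem_insert, Finset.mem_singleton, Prod.mk.injEq] at hx hx'
  rcases hx with ⟨hx1, hi⟩ | ⟨hx1, hi⟩ | ⟨hx1, hi⟩ | ⟨hx1, hi⟩ <;>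
    rcases hx' with ⟨hx2, hi'⟩ | ⟨hx2, hi'⟩ | ⟨hx2, hi'⟩ | ⟨hx2, hi'⟩
  all_goals first
    | exact Or.inl (hx2.trans hx1.symm)
    | exact absurd (hi.symm.trans hi') hne
    | exact absurd (hi'.symm.trans hi) hne
    | exact Or.inr ⟨b, fun h => hne (h.trans hi).symm, Or.inl (hx2.trans (congrArg (· + Pi.single b (1 : ℤ)) hx1).symm)⟩
    | exact Or.inr ⟨a, fun h => hne (h.trans hi), Or.inl (hx2.trans (congrArg (· + Pi.single a (1 : ℤ)) hx1).symm)⟩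
    | exact Or.inr ⟨b, fun h => hne (h.trans hi).symm, Or.inr (hx1.trans (congrArg (· + Pi.single b (1 : ℤ)) hx2).symm)⟩
    | exact Or.inr ⟨a, fun h => hne (h.trans hi), Or.inr (hx1.trans (congrArg (· + Pi.single a (1 : ℤ)) hx2).symm)⟩

/-- The base points `2k·e₁` (`d ≥ 2`): `x_k(l) = 2k` if `l = 1`, else `0`. Two of them never differ by a unit vector, and they are distinct for
distinct `k`. [folklore] -/
theorem lineSite_sub_ne_single (hd : 2 ≤ d) {k k' : ℕ} (hkk' : k ≠ k') (j : Fin d) :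
    (fun l : Fin d => if l = ⟨1, by omega⟩ then (2 * k : ℤ) else 0) ≠
        (fun l : Fin d => if l = ⟨1, by omega⟩ then (2 * k' : ℤ) else 0) + Pi.single j 1 ∧
      (fun l : Fin d => if l = ⟨1, by omega⟩ then (2 * k : ℤ) else 0) ≠
        (fun l : Fin d => if l = ⟨1, by omega⟩ then (2 * k' : ℤ) else 0) := by
  constructor
  · intro h
    have h1 := congrFun h j
    simp only [Pi.add_apply, Pi.single_eq_same] at h1
    split_ifs at h1 with hj
    · omega
    · omega
  · intro h
    have h1 := congrFun h ⟨1, by omega⟩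
    simp only [if_true] at h1
    omega

/-- ★★ **An explicit extensive family.**  `G ≅ SU(N)` (`N ≥ 2`), `d ≥ 2`, every real `β`, EVERY DLR state `μ`: with `e_k = (2k·e₁, 0)` the
direction-`0` links along the `1`-axis and `P_n = ⋃_{k<n} {plaquettes through e_k}` (at most `2(d−1)n` plaquettes),
`n · e^{−8(d−1)N|β|} · V₀ ≤ Var_μ(Σ_{p∈P_n} Re tr ρ(U_p))` — the energy variance is EXTENSIVE FROM BELOW along this family, uniformly in the
state. [folklore] -/
theorem variance_linePlaquettes_ge (hρ : IsSpecialUnitaryModel ρ) (hN : 2 ≤ N) (hd : 2 ≤ d) {β : ℝ} {μ : Measure (LGConfig d G)}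
    (hμ : μ ∈ ymGibbsMeasures ρ β) (n : ℕ) :
    ((n : ℝ) * Real.exp (-(8 * (d - 1 : ℕ) * N * |β|)) * PlaquetteLowerBound.charVariance ρ ≤
      Var[fun U : LGConfig d G => ∑ p ∈ (Finset.range n).biUnion (fun k : ℕ => plaquettesTouching
          {(((fun l : Fin d => if l = ⟨1, by omega⟩ then (2 * k : ℤ) else 0), (⟨0, by omega⟩ : Fin d)) :
            Literature.MathematicalPhysics.QuantumLattice.ZdEdge d)}), plaquetteObs ρ p.1 p.2.1.1 p.2.1.2 U; μ]) ∧
      ((Finset.range n).biUnion (fun k : ℕ => plaquettesTouching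
          {(((fun l : Fin d => if l = ⟨1, by omega⟩ then (2 * k : ℤ) else 0), (⟨0, by omega⟩ : Fin d)) :
            Literature.MathematicalPhysics.QuantumLattice.ZdEdge d)})).card ≤ 2 * (d - 1) * n := by
  classical
  set lk : ℕ → Literature.MathematicalPhysics.QuantumLattice.ZdEdge d := fun k =>
    ((fun l : Fin d => if l = ⟨1, by omega⟩ then (2 * k : ℤ) else 0), (⟨0, by omega⟩ : Fin d)) with hlk
  set F : Finset (Literature.MathematicalPhysics.QuantumLattice.ZdEdge d) := (Finset.range n).image lk with hF
  have hinj : Function.Injective lk := by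
    intro k k' h
    by_contra hkk'
    exact (lineSite_sub_ne_single hd hkk' ⟨0, by omega⟩).2 (congrArg Prod.fst h)
  have hFcard : F.card = n := by rw [hF, Finset.card_image_of_injective _ hinj, Finset.card_range]
  have hsep : ∀ e ∈ F, ∀ e' ∈ F, e ≠ e' → ∀ p : ZdPlaquette d, e ∈ plaquetteEdges p → e' ∉ plaquetteEdges p := by
    intro e he e' he' hne p hep hep'
    obtain ⟨k, -, rfl⟩ := Finset.mem_image.1 he
    obtain ⟨k', -, rfl⟩ := Finset.mem_image.1 he'
    have hkk' : k ≠ k' := fun h => hne (by rw [h])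
    rcases mem_plaquetteEdges_same_dir hep hep' with h | ⟨j, -, h | h⟩
    · exact (lineSite_sub_ne_single hd (Ne.symm hkk') ⟨0, by omega⟩).2 h
    · exact (lineSite_sub_ne_single hd (Ne.symm hkk') j).1 h
    · exact (lineSite_sub_ne_single hd hkk' j).1 h
  set P : Finset (ZdPlaquette d) := (Finset.range n).biUnion (fun k => plaquettesTouching {lk k}) with hP
  have hPsub : ∀ e ∈ F, plaquettesTouching {e} ⊆ P := by
    intro e he
    obtain ⟨k, hk, rfl⟩ := Finset.mem_image.1 he
    exact Finset.subset_biUnion_of_mem (fun k => plaquettesTouching {lk k}) hk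
  refine ⟨?_, ?_⟩
  · have h := card_mul_le_variance_plaquetteSum' ρ hρ hN hd hμ F hsep P hPsub
    rw [hFcard] at h
    exact h
  · calc P.card ≤ ∑ k ∈ Finset.range n, (plaquettesTouching {lk k}).card := Finset.card_biUnion_le
      _ ≤ ∑ _k ∈ Finset.range n, 2 * (d - 1) := Finset.sum_le_sum fun k _ => card_plaquettesTouching_singleton_le _
      _ = 2 * (d - 1) * n := by rw [Finset.sum_const, Finset.card_range, smul_eq_mul]; ring

end EnergyVariance

end Summit.Ventures.YMGap.RobustBall
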